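import Summits.QuantumFields.YangMills.Theorems.IR.Negative.TypOnsetFloorPoly.Freeze

/-!
# Crux `IR` (stmt-QuantumFields-19354) — the POLYNOMIAL ROW FLOOR `b⋆_T(β) ≥ c·(β / log β)^{1/7}` for EVERY compact gauge group,
# part 4/10: the Yang–Mills kernel tail and §4d ROUTE B: F_poly from the kernel-mean of the physical rectangle defect (sections `YMSpecTail`, `RouteB`)

Re-homed VERBATIM (statements, proofs, names; namespace `…Cruxes.IR.CruxIdea2g7` ↦ `…Cruxes.IR.RowFloorPoly`) from the crux
workfile `Cruxes/IR/CruxIdea2RowFloorPoly.lean` rev 14 (sha16 742d7312ea0b5c70; author `ym-cruxidea-19354-2` GEN 7; kernel certificate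
`Cruxes/IR/CruxIdea2RowFloorPolyCert.lean` rev 1, sha16 59d3cfe64fab9c7c, gate-elaborated stub-free) per owner R114 (2) (landing seat:
the `ym-19354-disprove-1` lineage, g9), split by its sections into ten ≤ 400-line modules chained by import; the module docstring of
record (history, theorem map, honest framing) is in the headline module `Theorems/IR/Negative/TypOnsetFloorPoly.lean` (part 10/10).
Negative knowledge for stmt-QuantumFields-19354 (`--supports`; closes no stub); not mixing, not a mass gap, nothing about Clay.
-/

set_option autoImplicit false

noncomputable section

open MeasureTheory Filter Topology
open Literature.MathematicalPhysics.QuantumLattice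
open Literature.Probability.LatticeModels
open Summit.QuantumFields.YangMills.Cruxes.IR.Tempered (cellEdges windowCells regionEdges)
open Summit.QuantumFields.YangMills.Cruxes.IR.ShellTempered (windowCellsPlus)
open Summit.QuantumFields.YangMills.Cruxes.IR.OnsetFormats (TypShellCond shellCount)
open Summit.QuantumFields.YangMills.Cruxes.IR.FixedMesh
open Summit.QuantumFields.YangMills.Cruxes.IR.FixedMeshAllG
open Summit.QuantumFields.YangMills.Theorems.FemtoCurvatureTwoPoint.DoublingOfRV (norm_rho_mul_sub_one_le norm_rho_inv_sub_one)
open Summit.QuantumFields.YangMills.Cruxes.IR.HairpinStokes (norm_map_conj_sub_one sub_re_trace_eq_norm_sq)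
open Literature.MathematicalPhysics.QuantumFieldTheory (abs_re_trace_le_sqrt_mul re_trace_map_inv)

namespace Summit.QuantumFields.YangMills.Cruxes.IR.RowFloorPoly

section YMSpecTail

open Literature.MathematicalPhysics.QuantumFieldTheory (haarProbability)

variable {G : Type} [Group G] [TopologicalSpace G] [IsTopologicalGroup G] [CompactSpace G]
  [SecondCountableTopology G] [MeasurableSpace G] [BorelSpace G]
  {d N : ℕ} (ρ : G →* Matrix (Fin N) (Fin N) ℂ)

omit [TopologicalSpace G] [IsTopologicalGroup G] [CompactSpace G] [SecondCountableTopology G] [MeasurableSpace G]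
  [BorelSpace G] in
/-- The boundary Wilson action is non-negative for unitary `ρ`. -/
theorem wilsonBoundaryAction_nonneg (hρu : ∀ g, ρ g ∈ Matrix.unitaryGroup (Fin N) ℂ) (Λ : Finset (ZdEdge d))
    (U : LGConfig d G) : 0 ≤ wilsonBoundaryAction ρ Λ U :=
  Finset.sum_nonneg fun p _ => by
    have := (abs_le.1 (abs_plaquetteObs_le_holds ρ hρu p.1 p.2.1.1 p.2.1.2 U)).2
    linarith

/-- **The energy–entropy tail FOR THE YANG–MILLS DLR KERNEL (PROVED).**  `ymSpecification ρ β Λ η` is, by definition, the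
Gibbs tilt of the glued product Haar measure `μ_{Λ,η}` by `−β · wilsonBoundaryAction ρ Λ`; hence for every `a`, `s` with
`μ_{Λ,η}{A ≤ s} > 0`:  `γ_Λ(· | η){a < A} ≤ e^{−β(a−s)} / μ_{Λ,η}{A ≤ s}`. -/
theorem ymSpecification_tail_le (hρ : Continuous ρ) (hρu : ∀ g, ρ g ∈ Matrix.unitaryGroup (Fin N) ℂ) {β : ℝ}
    (hβ : 0 ≤ β) (Λ : Finset (ZdEdge d)) (η : LGConfig d G) (a s : ℝ)
    (hs : 0 < ((Measure.pi fun _ : ↥Λ => haarProbability G).map (glueWith Λ · η)).real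
      {U | wilsonBoundaryAction ρ Λ U ≤ s}) :
    (ymSpecification ρ β Λ η).real {U | a < wilsonBoundaryAction ρ Λ U} ≤
      Real.exp (-(β * (a - s))) /
        ((Measure.pi fun _ : ↥Λ => haarProbability G).map (glueWith Λ · η)).real
          {U | wilsonBoundaryAction ρ Λ U ≤ s} := by
  haveI : IsProbabilityMeasure ((Measure.pi fun _ : ↥Λ => haarProbability G).map (glueWith Λ · η)) :=
    Measure.isProbabilityMeasure_map (measurable_glueWith Λ η).aemeasurable
  have h := gibbsTail_le ((Measure.pi fun _ : ↥Λ => haarProbability G).map (glueWith Λ · η))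
    (continuous_wilsonBoundaryAction ρ hρ Λ).measurable (wilsonBoundaryAction_nonneg ρ hρu Λ) hβ a s hs
  have e : ymSpecification ρ β Λ η =
      ((Measure.pi fun _ : ↥Λ => haarProbability G).map (glueWith Λ · η)).tilted
        fun U => -(β * wilsonBoundaryAction ρ Λ U) := by
    simp only [ymSpecification, neg_mul]
  rw [e]
  exact h

omit [TopologicalSpace G] [IsTopologicalGroup G] [CompactSpace G] [SecondCountableTopology G] [MeasurableSpace G]
  [BorelSpace G] in
/-- The boundary Wilson action is at most `2N · #(plaquettes touching Λ)` (unitary `ρ`; rev 9). -/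
theorem wilsonBoundaryAction_le_card (hρu : ∀ g, ρ g ∈ Matrix.unitaryGroup (Fin N) ℂ) (Λ : Finset (ZdEdge d))
    (U : LGConfig d G) : wilsonBoundaryAction ρ Λ U ≤ 2 * N * (plaquettesTouching Λ).card := by
  unfold wilsonBoundaryAction
  have h : ∀ p ∈ plaquettesTouching Λ, ((N : ℝ) - plaquetteObs ρ p.1 p.2.1.1 p.2.1.2 U) ≤ 2 * N :=
    fun p _ => by
      have := (abs_le.1 (abs_plaquetteObs_le_holds ρ hρu p.1 p.2.1.1 p.2.1.2 U)).1
      linarith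
  calc ∑ p ∈ plaquettesTouching Λ, ((N : ℝ) - plaquetteObs ρ p.1 p.2.1.1 p.2.1.2 U)
      ≤ ∑ _p ∈ plaquettesTouching Λ, (2 * (N : ℝ)) := Finset.sum_le_sum h
    _ = 2 * N * (plaquettesTouching Λ).card := by rw [Finset.sum_const, nsmul_eq_mul]; ring

/-- **The energy–entropy MEAN bound FOR THE YANG–MILLS DLR KERNEL (PROVED; rev 9)** — the tool of step (b) of the §5 plan:
for `β > 0`, `s, t ≥ 0` and reference mass `π_{Λ,η}{A ≤ s} > 0` (`π_{Λ,η}` = glued product Haar, `A = wilsonBoundaryAction ρ Λ`):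
`E_{γ_Λ(·|η)} A ≤ s + (log(1/π_{Λ,η}{A ≤ s}) + t)/β + 2N·#touching(Λ) · e^{−t}`. -/
theorem ymSpecification_mean_action_le (hρ : Continuous ρ) (hρu : ∀ g, ρ g ∈ Matrix.unitaryGroup (Fin N) ℂ) {β : ℝ}
    (hβ : 0 < β) (Λ : Finset (ZdEdge d)) (η : LGConfig d G) {s t : ℝ} (hs0 : 0 ≤ s) (ht : 0 ≤ t)
    (hs : 0 < ((Measure.pi fun _ : ↥Λ => haarProbability G).map (glueWith Λ · η)).real
      {U | wilsonBoundaryAction ρ Λ U ≤ s}) :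
    ∫ U, wilsonBoundaryAction ρ Λ U ∂(ymSpecification ρ β Λ η) ≤
      s + (Real.log (1 / ((Measure.pi fun _ : ↥Λ => haarProbability G).map (glueWith Λ · η)).real
            {U | wilsonBoundaryAction ρ Λ U ≤ s}) + t) / β +
        2 * N * (plaquettesTouching Λ).card * Real.exp (-t) := by
  haveI : IsProbabilityMeasure ((Measure.pi fun _ : ↥Λ => haarProbability G).map (glueWith Λ · η)) :=
    Measure.isProbabilityMeasure_map (measurable_glueWith Λ η).aemeasurable
  have h := gibbsMean_le ((Measure.pi fun _ : ↥Λ => haarProbability G).map (glueWith Λ · η))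
    (continuous_wilsonBoundaryAction ρ hρ Λ).measurable (wilsonBoundaryAction_nonneg ρ hρu Λ)
    (wilsonBoundaryAction_le_card ρ hρu Λ) hβ hs0 ht hs
  have e : ymSpecification ρ β Λ η =
      ((Measure.pi fun _ : ↥Λ => haarProbability G).map (glueWith Λ · η)).tilted
        fun U => -(β * wilsonBoundaryAction ρ Λ U) := by
    simp only [ymSpecification, neg_mul]
  rw [e]
  exact h

end YMSpecTail

/-! ## §4d ROUTE B (PROVED): F_poly reduces to the kernel-mean of the PHYSICAL rectangle defect in the twisted world

The observation (new in rev 3): the layer twist `σ' = topTwist_b(k) σ` touches exactly ONE link of the staple — the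
down-run link `((b, m, 0, 0), 0)`, multiplied on the right by `k(b+1, m, 0, 0)⁻¹` — so
`staple(σ') = T · k_r · T⁻¹ · staple(σ)` (`T` = top run, `k_r = k(b+1,m,0,0)`), and for the comb twist
`k_r = s⁻¹ k₀ s` is a conjugate of `k₀`.  Hence, for EVERY `σ` and `U` (no flatness, no comb coherence, no defect):
`col U · staple σ = H'(U) · g k₀⁻¹ g⁻¹` with `H'(U) = col U · staple(σ')` THE PHYSICAL HOLONOMY OF THE GLUED
CONFIGURATION `U ∨ σ'` around the rectangle.  With §4c this gives, pointwise in `V`,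
`twistedMeanObs(V) ≤ −1 + C_r · E_{γ_Λ(·|σ'_V)} ‖ρ(H'(U)) − 1‖_F`, `C_r = 2/((1−r)√N)`: INPUT F_poly follows from a
tail bound on the kernel-mean `twistDefect` of a GAUGE-INVARIANT physical quantity (`KernelDefectPoly`), by set
inclusion (no measurability of `V ↦ twistedMeanObs V` needed).  The kernel gauge-covariance step (2) of the rev-2 plan
is thereby UNNECESSARY. -/

section RouteB

open scoped Matrix Matrix.Norms.Frobenius
open Literature.MathematicalPhysics.QuantumFieldTheory (wilsonMeasure GaugeConfig isProbabilityMeasure_wilsonMeasure)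
open Summit.QuantumFields.YangMills.Theorems.TunedSequenceExists.Negative.Freezing (integrable_of_continuous)

variable {G : Type} [Group G] [TopologicalSpace G] [IsTopologicalGroup G] [CompactSpace G]
  [SecondCountableTopology G] [MeasurableSpace G] [BorelSpace G]
  {N : ℕ} (ρ : G →* Matrix (Fin N) (Fin N) ℂ)

/-- The top run of the staple: `m` forward links in direction `1` at height `b + 1`. -/
def topRun (b m : ℕ) (U : LGConfig 4 G) : G :=
  ((List.range m).map fun s : ℕ => U (site2 ((b : ℤ) + 1) s, 1)).prod

omit [TopologicalSpace G] [IsTopologicalGroup G] [CompactSpace G] [SecondCountableTopology G] [MeasurableSpace G]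
  [BorelSpace G] in
/-- Helper lemma `staple_eq_topRun_mul` of the row-floor chain (re-homed verbatim from the crux workfile; see the module docstring). -/
theorem staple_eq_topRun_mul (b m : ℕ) (U : LGConfig 4 G) :
    staple b m U = topRun b m U * (((((List.range (b + 1)).reverse).map fun t : ℕ => (U (site2 t m, 0))⁻¹).prod *
      ((((List.range m).reverse).map fun s : ℕ => (U (site2 0 s, 1))⁻¹).prod * U (site2 0 0, 0)))) := rfl

omit [TopologicalSpace G] [IsTopologicalGroup G] [CompactSpace G] [SecondCountableTopology G] [MeasurableSpace G]
  [BorelSpace G] in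
/-- The layer twist off height `b`. -/
theorem topTwist_site2_of_ne {b : ℕ} (k : Site 4 → G) (U : LGConfig 4 G) {t : ℤ} (ht : t ≠ (b : ℤ)) (s : ℤ)
    (i : Fin 4) : topTwist b k U (site2 t s, i) = U (site2 t s, i) :=
  topTwist_apply_of_ne k U ht

omit [TopologicalSpace G] [IsTopologicalGroup G] [CompactSpace G] [SecondCountableTopology G] [MeasurableSpace G]
  [BorelSpace G] in
/-- The layer twist on the time link at height `b`. -/
theorem topTwist_site2_height {b : ℕ} (k : Site 4 → G) (U : LGConfig 4 G) (s : ℤ) :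
    topTwist b k U (site2 (b : ℤ) s, 0) = U (site2 (b : ℤ) s, 0) * (k (site2 ((b : ℤ) + 1) s))⁻¹ := by
  unfold topTwist
  rw [if_pos ⟨rfl, rfl⟩, site2_add_single_zero]

omit [TopologicalSpace G] [IsTopologicalGroup G] [CompactSpace G] [SecondCountableTopology G] [MeasurableSpace G]
  [BorelSpace G] in
/-- **The twist seen by the staple (PROVED).**  `staple(topTwist_b(k) U) = T · k(b+1, m) · T⁻¹ · staple(U)`, `T` the top
run: of the staple's links only the down-run link at height `b` is twisted (`1 ≤ b` keeps the closing link untwisted). -/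
theorem staple_topTwist {b : ℕ} (hb : 1 ≤ b) (m : ℕ) (k : Site 4 → G) (U : LGConfig 4 G) :
    staple b m (topTwist b k U) =
      topRun b m U * k (site2 ((b : ℤ) + 1) m) * (topRun b m U)⁻¹ * staple b m U := by
  have hb0 : (0 : ℤ) ≠ (b : ℤ) := by
    have : (1 : ℤ) ≤ b := by exact_mod_cast hb
    omega
  have hb1 : (b : ℤ) + 1 ≠ (b : ℤ) := by omega
  have htop : topRun b m (topTwist b k U) = topRun b m U := by
    unfold topRun
    simp only [topTwist_site2_of_ne k U hb1]
  have hrest : ((List.range b).reverse.map fun t : ℕ => (topTwist b k U (site2 t m, 0))⁻¹) =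
      (List.range b).reverse.map fun t : ℕ => (U (site2 t m, 0))⁻¹ := by
    refine List.map_congr_left fun t ht => ?_
    have htb : (t : ℤ) ≠ (b : ℤ) := by
      have := List.mem_range.1 (List.mem_reverse.1 ht)
      omega
    rw [topTwist_site2_of_ne k U htb]
  have hdown : ((List.range (b + 1)).reverse.map fun t : ℕ => (topTwist b k U (site2 t m, 0))⁻¹).prod =
      k (site2 ((b : ℤ) + 1) m) * ((List.range (b + 1)).reverse.map fun t : ℕ => (U (site2 t m, 0))⁻¹).prod := by
    rw [List.range_succ, List.reverse_append, List.reverse_singleton, List.singleton_append, List.map_cons,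
      List.map_cons, List.prod_cons, List.prod_cons, hrest, topTwist_site2_height, mul_inv_rev, inv_inv, mul_assoc]
  have hbot : ((List.range m).reverse.map fun s : ℕ => (topTwist b k U (site2 0 s, 1))⁻¹) =
      (List.range m).reverse.map fun s : ℕ => (U (site2 0 s, 1))⁻¹ := by
    simp only [topTwist_site2_of_ne k U hb0]
  rw [staple_eq_topRun_mul, staple_eq_topRun_mul, htop, hdown, hbot, topTwist_site2_of_ne k U hb0]
  group

omit [TopologicalSpace G] [IsTopologicalGroup G] [CompactSpace G] [SecondCountableTopology G] [MeasurableSpace G]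
  [BorelSpace G] in
/-- **ROUTE B IDENTITY (PROVED, every `σ`, `U`, no flatness).**  The `σ`-adapted charged holonomy is the PHYSICAL
rectangle holonomy of the glued configuration `U ∨ σ'` in the comb-twisted world, times a conjugate of `k₀⁻¹`:
`col U · staple σ = (col U · staple σ') · g k₀⁻¹ g⁻¹`, `σ' = topTwist_b(comb_b k₀ σ) σ`. -/
theorem col_mul_staple_eq_twisted {b : ℕ} (hb : 1 ≤ b) (R m : ℕ) (k₀ : G) (σ U : LGConfig 4 G) :
    ∃ g : G, col b U * staple b m σ =
      col b U * staple b m (topTwist b (comb b R k₀ σ) σ) * (g * k₀⁻¹ * g⁻¹) := by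
  refine ⟨(staple b m (topTwist b (comb b R k₀ σ) σ))⁻¹ * topRun b m σ *
    (stair b R σ (site2 ((b : ℤ) + 1) m))⁻¹, ?_⟩
  rw [staple_topTwist hb m (comb b R k₀ σ) σ]
  simp only [comb]
  group

omit [TopologicalSpace G] [IsTopologicalGroup G] [CompactSpace G] [SecondCountableTopology G] [MeasurableSpace G]
  [BorelSpace G] in
/-- **Pointwise consequence (PROVED):** `clip r (Re g_σ(U)) ≤ −1 + C_r ‖ρ(col U · staple σ') − 1‖_F`. -/
theorem clip_chargedTest_re_le (hρu : ∀ g, ρ g ∈ Matrix.unitaryGroup (Fin N) ℂ) (hN : 1 ≤ N) {k₀ : G}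
    (hr : (ρ k₀).trace.re / N < 1) {b : ℕ} (hb : 1 ≤ b) (R m : ℕ) (σ U : LGConfig 4 G) :
    clip ((ρ k₀).trace.re / N) (chargedTest ρ b m σ U).re ≤
      -1 + 2 / ((1 - (ρ k₀).trace.re / N) * Real.sqrt N) *
        ‖ρ (col b U * staple b m (topTwist b (comb b R k₀ σ) σ)) - 1‖ := by
  obtain ⟨g, hg⟩ := col_mul_staple_eq_twisted hb R m k₀ σ U
  have hre : (chargedTest ρ b m σ U).re =
      (ρ (col b U * staple b m (topTwist b (comb b R k₀ σ) σ) * (g * k₀⁻¹ * g⁻¹))).trace.re / N := by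
    rw [chargedTest, hg, Complex.div_natCast_re]
  rw [hre]
  exact clip_re_trace_twisted_le ρ hρu hN hr _ g

/-- The kernel-mean of the PHYSICAL rectangle defect in the comb-twisted world (the quantity Route B reduces F_poly to). -/
def twistDefect (β : ℝ) (b n : ℕ) (k₀ : G) (V : GaugeConfig 4 (2 * ((2 * n + 2) * b + 1) + 1) G) : ℝ :=
  ∫ U, ‖ρ (col b U * staple b ((2 * n + 1) * b)
      (twistΦ b (comb b ((2 * n + 2) * b + 1) k₀) (torusLift (2 * ((2 * n + 2) * b + 1) + 1) V))) - 1‖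
    ∂(ymSpecification ρ β (rowRegion b n)
        (twistΦ b (comb b ((2 * n + 2) * b + 1) k₀) (torusLift (2 * ((2 * n + 2) * b + 1) + 1) V)))

/-- **The twisted mean is controlled by the twist defect (PROVED):**
`twistedMeanObs(V) ≤ −1 + C_r · twistDefect(V)`, `C_r = 2/((1−r)√N)`, for EVERY torus sample `V`. -/
theorem twistedMeanObs_clip_le (hρ : Continuous ρ) (hρu : ∀ g, ρ g ∈ Matrix.unitaryGroup (Fin N) ℂ) (hN : 1 ≤ N)
    {k₀ : G} (hr : (ρ k₀).trace.re / N < 1) {b : ℕ} (hb : 1 ≤ b) (n : ℕ) (β : ℝ)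
    (V : GaugeConfig 4 (2 * ((2 * n + 2) * b + 1) + 1) G) :
    twistedMeanObs ρ β b n (comb b ((2 * n + 2) * b + 1) k₀) (clip ((ρ k₀).trace.re / N)) V ≤
      -1 + 2 / ((1 - (ρ k₀).trace.re / N) * Real.sqrt N) * twistDefect ρ β b n k₀ V := by
  unfold twistedMeanObs twistDefect
  set m : ℕ := (2 * n + 1) * b with hm
  set σ : LGConfig 4 G := torusLift (2 * ((2 * n + 2) * b + 1) + 1) V with hσ
  set σ' : LGConfig 4 G := twistΦ b (comb b ((2 * n + 2) * b + 1) k₀) σ with hσ'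
  set γ := ymSpecification ρ β (rowRegion b n) σ' with hγ
  set C : ℝ := 2 / ((1 - (ρ k₀).trace.re / N) * Real.sqrt N) with hC
  haveI : IsProbabilityMeasure γ := isProbabilityMeasure_ymSpecification ρ hρ β _ _
  have hint1 : Integrable (fun U => clip ((ρ k₀).trace.re / N) (chargedTest ρ b m σ U).re) γ :=
    integrable_of_continuous γ
      ((continuous_clip _).comp (Complex.continuous_re.comp (continuous_chargedTest ρ hρ _ _ σ)))
  have hcontD : Continuous fun U : LGConfig 4 G => ‖ρ (col b U * staple b m σ') - 1‖ :=
    ((hρ.comp ((continuous_col b).mul continuous_const)).sub continuous_const).norm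
  have hintD : Integrable (fun U : LGConfig 4 G => ‖ρ (col b U * staple b m σ') - 1‖) γ :=
    integrable_of_continuous γ hcontD
  have hint2 : Integrable (fun U : LGConfig 4 G => -1 + C * ‖ρ (col b U * staple b m σ') - 1‖) γ :=
    (integrable_const _).add (hintD.const_mul C)
  have hpt : ∀ U : LGConfig 4 G,
      clip ((ρ k₀).trace.re / N) (chargedTest ρ b m σ U).re ≤ -1 + C * ‖ρ (col b U * staple b m σ') - 1‖ :=
    fun U => clip_chargedTest_re_le ρ hρu hN hr hb ((2 * n + 2) * b + 1) m σ U
  calc ∫ U, clip ((ρ k₀).trace.re / N) (chargedTest ρ b m σ U).re ∂γ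
      ≤ ∫ U, (-1 + C * ‖ρ (col b U * staple b m σ') - 1‖) ∂γ := integral_mono hint1 hint2 hpt
    _ = -1 + C * ∫ U, ‖ρ (col b U * staple b m σ') - 1‖ ∂γ := by
        rw [integral_add (integrable_const _) (hintD.const_mul C), integral_const, integral_const_mul, smul_eq_mul]
        simp

/-- **INPUT K_poly — the twist-defect tail along the regime** (what Route B reduces F_poly to): for every `η > 0` there
are `c > 0`, `β₀` with `μ_{L_b,β}{V | η < twistDefect(V)} ≤ η` for all `(β, b)` in `polyRegime θ c β₀`. -/
def KernelDefectPoly (n : ℕ) (k₀ : G) (θ : ℝ) : Prop :=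
  ∀ η : ℝ, 0 < η → ∃ c : ℝ, 0 < c ∧ ∃ β₀ : ℝ, polyRegime θ c β₀ fun β b =>
    (wilsonMeasure (d := 4) (L := 2 * ((2 * n + 2) * b + 1) + 1) ρ β)
        {V | η < twistDefect ρ β b n k₀ V} ≤ ENNReal.ofReal η

/-- **F_poly from K_poly (PROVED):** by `twistedMeanObs_clip_le` and set inclusion,
`{−1 + η < twistedMeanObs} ⊆ {min η (η/C_r) < twistDefect}`. -/
theorem frameValuePoly_of_kernelDefectPoly (hρ : Continuous ρ) (hρu : ∀ g, ρ g ∈ Matrix.unitaryGroup (Fin N) ℂ)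
    (hN : 1 ≤ N) {k₀ : G} (hr : (ρ k₀).trace.re / N < 1) {n : ℕ} {θ : ℝ}
    (h : KernelDefectPoly ρ n k₀ θ) : FrameValuePoly ρ n k₀ θ := by
  intro η hη
  have hN0 : (0 : ℝ) < N := by exact_mod_cast hN
  have h1r : 0 < 1 - (ρ k₀).trace.re / N := by linarith
  set C : ℝ := 2 / ((1 - (ρ k₀).trace.re / N) * Real.sqrt N) with hC
  have hCpos : 0 < C := div_pos two_pos (mul_pos h1r (Real.sqrt_pos.2 hN0))
  set η₁ : ℝ := min η (η / C) with hη₁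
  have hη₁pos : 0 < η₁ := lt_min hη (div_pos hη hCpos)
  obtain ⟨c, hc, β₀, hreg⟩ := h η₁ hη₁pos
  refine ⟨c, hc, β₀, fun β hβ b hb hbc => ?_⟩
  have hK := hreg β hβ b hb hbc
  refine le_trans (measure_mono fun V hV => ?_) (hK.trans (ENNReal.ofReal_le_ofReal (min_le_left _ _)))
  simp only [Set.mem_setOf_eq] at hV ⊢
  have hle := twistedMeanObs_clip_le ρ hρ hρu hN hr hb n β V
  have h1 : η < C * twistDefect ρ β b n k₀ V := by linarith
  have h2 : η / C < twistDefect ρ β b n k₀ V := by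
    rw [div_lt_iff₀ hCpos]; linarith
  exact lt_of_le_of_lt (min_le_right _ _) h2

end RouteB

end Summit.QuantumFields.YangMills.Cruxes.IR.RowFloorPoly

end
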